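import Literature.MathematicalPhysics.QuantumFieldTheory.Dimock2015.AnalyticLipschitz
import Summits.QuantumFields.BalabanUV.T4Continuum.Support.NE9Lemma1KernelSpecies

/-!
# NE9CouplingHolomorphyLipschitz — leaf A3's COUPLING-LIPSCHITZ binders FROM HOLOMORPHY IN THE LAST COUPLING: the direction
# map's (d2) of the ray ∕ curve species and the bilocal summand's (K-Lip) of the kernel species DERIVED, with the constants
# `clip = λ = 2∕ϱ` explicit, from a map holomorphic in the k-th coupling on the complex ϱ-discs about the window's couplings
# obeying there the SAME size binder already displayed at real coupling (cell `pub-balaban`, T4-DAG §2 node U3 ∕ §6 NE9; NE9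
# formalisation swarm, unit `b2b-balaban-t4-ne9-formalise-leaf-03` gen 5; own-initiative lineage item «A3-HOL», CLAIMS.log
# l.12175, at own risk — the follow-through of this lineage's A3-REM gloss F-ne9leaf03g4-1 «the Cauchy-estimate reading»)

HONEST FRAMING (T4-DAG PAGE 1).  Rung (B)+1 of the FINITE-VOLUME T⁴ programme — existence AND uniqueness of the ε → 0 limit
of gauge-invariant observables on a fixed torus; NOT infinite volume, NOT a mass gap, NOT the Clay problem.  NE9
(`T4OutputRate.NE9` ∧ `FadingMemory`) is a cell NEW ESTIMATE, NOT PRINTED, and is NOT discharged here («NE9 ⇐ the named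
binders»); spine 0∕9; 0∕18 skeleton leaves instantiated on Bałaban's objects (O-NE9-1).  HONEST DEPENDENCY (cell line,
verbatim): continuum YM on T⁴ ⇐ BetaPertH ∧ nine spine estimates (0/9 proved); BetaPertH ⇐ (D1) ∧ (D4) ∧ CAP+tail; G-an2-4
gates asym, D1 and NE2/3/4.  [I] = [Balaban1987RG1] (CMP **109**), [II] = [Balaban1988RG2Cluster] (CMP **116**) are quoted for
TYPES only (ABSOLUTE RULE: nothing printed in the audited series is asserted).  No `def`, no Prop-valued definition (trigger
c3: A3's binders stay displayed hypotheses); `FlowStep.BetaPertH`, (B), (B^μ) do not occur.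

WHERE THIS SITS.  Leaf A3 of the NE9 END (`hTcup`: the channel read at two values of the LAST coupling on the SAME old terms) is
KERNEL AT FORM LEVEL for both species families of leaf S5 modulo ONE coupling-regularity binder each, displayed with NO printed
constant and labelled PROOF-INTERIOR:
* (d2) `hlip` of `NE9RemainderSpeciesCoupling.cpieceResponse_rem` (this lineage, p213083) — consumed UNCHANGED by the curve
  species of Bałaban's shape through `NE9CurveFromBackgroundMap.lip_compCur` ∕ `cpieceResponse_compCur` (leaf-05-g5, p215194):
  the (1.23) contour DIRECTION `D.dir k g …` ([II] (1.23) p. 7 ∕ [I] (3.36) p. 277: `(tζ̃_□ + t_□ζ_□)𝐇_k(σ)B′`) is LIPSCHITZ in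
  the k-th coupling on the contours with modulus `clip·(c_dir·ℓ k j·R_X)` — "per unit of the direction's (3.36)-TYPE size";
* (K-Lip) `hkerL` of `NE9KernelSpeciesCoupling.cpieceResponse_ker` ∕ `channelCouplingModulus_ker` (leaf-09-g6, p214870): the
  bilocal SUMMAND of [I] §4's point-localized terms is Lipschitz in the k-th coupling with the (K)-shape bound times a RELATIVE
  modulus `λ`.
In print the coupling enters both objects through `B′ = g_kCB − hD̃(g_kCB)` and explicit powers of `g_k` ([I] (2.12) p. 268,
(3.2) p. 270), composed with functions ANALYTIC on the complex spaces (1.34) ([II] Lemmas 1–2 p. 9–11; p. 6 last ¶ *"𝐇_k(s(Y₀),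
B′) is an analytic function of s(Y₀), B"*) — the structure by which the row owner's route P1 obtains holomorphy in a DILATED
coupling and then a Lipschitz modulus by a Cauchy estimate ([S1-c]: census E18 → E28 of `t4/T4-EST-NE9-P1.md`, kernel
`NE9DilatedTables` ∕ `NE9CouplingTwoPoint.norm_sub_le_of_holoOn_dilation`; the whole-functional version is the tree's
`T4CouplingAnalyticity`).  THIS FILE reads that premise ONE LEVEL INSIDE leaf A3, at the species' own objects:
* §1 ENGINE **`norm_sub_le_of_holo_pair`** — `Φ : ℂ → F` holomorphic on the open ϱ-disc about the real point `s′`, bounded by `B`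
  there and at the real point `s` ⟹ `‖Φ s − Φ s′‖ ≤ (2B∕ϱ)·|s − s′|`: the Schwarz lemma at the centre (tree
  `Dimock2015.norm_sub_centre_le`, no completeness of `F`) when `|s − s′| < ϱ`, the triangle bound `2B ≤ (2B∕ϱ)|s − s′|` otherwise.
  NO interval ∕ convexity structure on the set of couplings is needed (contrast `Dimock2015.real_param_lipschitz`: a segment,
  closed discs inside one domain, constant 4M∕ϱ); `norm_sub_le_of_holo_pair'` = the two-disc form used in §2–§3.
* §2 **`dirLip_of_holo`** — conclusion LITERALLY the (d2) binder `hlip` of `cpieceResponse_rem` ∕ `cpieceResponse_compCur` with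
  **`clip := 2∕ϱ`**, from three DISPLAYED binders on a coupling-complexified direction map `dirZ k ζ …` (a bound variable, not a
  definition): (res) on `W` the direction is its restriction at `ζ = g k`; (hol) `ζ ↦ dirZ k ζ …` is holomorphic on the disc
  `|ζ − g k| < ϱ` for every `g ∈ W`, at every contour point; (size) the (3.36)-TYPE relative size `‖dirZ k ζ …‖ ≤ c_dir·ℓ k j·R_X`
  holds ON THAT DISC (at real coupling it is `RemData.Admissible.dir_le` ∘ `dirB_le`).
* §3 **`kerLip_of_holo`** — conclusion LITERALLY the (K-Lip) binder `hkerL` of `cpieceResponse_ker` ∕ `channelCouplingModulus_ker`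
  with **`λ := 2∕ϱ`**, from (res) ∕ (hol) ∕ (K-on-the-disc) for a coupling-complexified summand `kerZ k ζ … p q F` (for every `F`
  analytic on the source's ball and bounded by `M` there, the (K)-shape bound `cK·M·gain k j·(ρd p q)^m·e^{−δ₀(dX p + dX q)}` holds on
  the disc — at real coupling it is `KerData.Admissible.kerBound`).
* §4 non-vacuity (`example`s): a direction AFFINE in the coupling and a summand LINEAR in the coupling meet (res)∕(hol)∕(size).
So after this file leaf A3's coupling-regularity inputs for both species families are [S1-c]-TYPE HOLOMORPHY binders + a kernel
Cauchy layer with explicit constants — the standing route P1 gives its own [S1-c] (printed-TYPE instance composed with printed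
STRUCTURE, NOT a printed statement) — instead of Lipschitz binders with unnamed constants.  k-UNIFORMITY of `2∕ϱ` is exactly
k-uniformity of the disc radius IN THE CURRENCY OF `W` (trigger c5: in `t = g⁻²` Bałaban's relative dilation `|z − g_k| ≤ c·g_k`
of [I] (2.12) contains t-discs of radius bounded below on `]0, γ]`; the tree's currency lemmas are `T4CouplingAnalyticity`
`real_param_lipschitz_relW` ∕ `couplingAnalyticOn_of_rel` ∕ `ne9_tCoord_of_ne9`) — displayed, not adjudicated (c6).  NOT PRINTED
and not claimed: that Bałaban's (1.23) directions or §4 kernels meet (res)∕(hol)∕(size) (O-NE9-1 ∕ O-NE9-5).  The by-name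
corollaries at the species (`cpieceResponse_compCur` ∕ `cpieceResponse_ker` ∕ `channelCouplingModulus_ker` with the Lipschitz
binder PRODUCED) are the sibling `NE9SpeciesCouplingHolomorphy`.  DISGUISE TEST: last coupling only; ONE direction ∕ ONE summand
at two values of `g k`; no history comparison of terms; not NE9.

WHAT IS PROVED (kernel, `[folklore]`; 0 sorry, 0 `def`): §1 `norm_real_sub_real`, `norm_sub_le_of_holo_pair`, `norm_sub_le_of_holo_pair'`; §2 `dirLip_of_holo`;
§3 `kerLip_of_holo`; §4 two `example`s.

References (TYPES only): [Balaban1987RG1] T. Bałaban, CMP **109** (1987) 249–301 — (2.12) p. 268, (3.2) p. 270, (3.36) p. 277,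
(4.21)–(4.22) pp. 285–286; [Balaban1988RG2Cluster] T. Bałaban, CMP **116** (1988) 1–22 — p. 6 last ¶, (1.23)–(1.25) p. 7, (1.34)
p. 9, Lemma 2 p. 11; template (PUBLISHED, outside the audited series): [DimockYuan2024GNFlow] proof of Thm 4 «the analyticity
implies Lipschitz continuity in x_k» (tree `Dimock2015.AnalyticLipschitz`).  Summits-side NEW work (LEAN PLACEMENT RULE); imports
the owner's `NE9Lemma1KernelSpecies` (p214555; hence `NE9Lemma1RemainderSpecies`) and the tree's `Dimock2015.AnalyticLipschitz` BY
NAME; modifies nothing; no END face re-wired.  Value = a binder REDUCTION inside leaf A3 (two PROOF-INTERIOR Lipschitz binders ↦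
[S1-c]-TYPE holomorphy binders, constants explicit), NOT summit progress.
-/

noncomputable section

namespace Summit.QuantumFields.BalabanUV.T4Continuum.NE9CouplingHolomorphyLipschitz

open scoped BigOperators
open Metric Set Complex
open Literature.MathematicalPhysics.QuantumFieldTheory.Balaban1983to89
open Literature.MathematicalPhysics.QuantumFieldTheory.Balaban1983to89.T4OutputRate
open Literature.MathematicalPhysics.QuantumFieldTheory.Dimock2015 (norm_sub_centre_le)
open Summit.QuantumFields.BalabanUV.T4Continuum.NE9Lemma1RemainderSpecies
open Summit.QuantumFields.BalabanUV.T4Continuum.NE9Lemma1KernelSpecies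
open Summit.QuantumFields.BalabanUV.T4Continuum.NE9ComplexEncoding (doubleCarriers)

/-! ## §1 The engine: holomorphy on the ϱ-discs about two real points ⟹ a Lipschitz bound between them -/

section Engine

variable {F : Type*} [NormedAddCommGroup F] [NormedSpace ℂ F]

/-- `‖(s : ℂ) − (s′ : ℂ)‖ = |s − s′|`. [folklore] -/
theorem norm_real_sub_real (s s' : ℝ) : ‖(s : ℂ) - (s' : ℂ)‖ = |s - s'| := by
  rw [← ofReal_sub, norm_real, Real.norm_eq_abs]

/-- **THE ENGINE.**  If `Φ : ℂ → F` is complex differentiable on the open disc of radius `ϱ` about the real point `s′`, bounded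
by `B` there, and also `‖Φ s‖ ≤ B` at the real point `s`, then `‖Φ s − Φ s′‖ ≤ (2B∕ϱ)·|s − s′|`.  Near pairs (`|s − s′| < ϱ`): the
Schwarz lemma at the centre `s′` (`Dimock2015.norm_sub_centre_le`, Mathlib `Complex.dist_le_div_mul_dist_of_mapsTo_ball` inside;
no completeness of `F`); far pairs: `‖Φ s‖ + ‖Φ s′‖ ≤ 2B = (2B∕ϱ)·ϱ ≤ (2B∕ϱ)·|s − s′|`.  No interval structure on the couplings is
used. [folklore] -/
theorem norm_sub_le_of_holo_pair {Φ : ℂ → F} {s s' ϱ B : ℝ} (hϱ : 0 < ϱ) (hBs : ‖Φ s‖ ≤ B)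
    (hs' : DifferentiableOn ℂ Φ (ball (s' : ℂ) ϱ)) (hBs' : ∀ z ∈ ball (s' : ℂ) ϱ, ‖Φ z‖ ≤ B) :
    ‖Φ s - Φ s'‖ ≤ 2 * B / ϱ * |s - s'| := by
  have hB : 0 ≤ B := (norm_nonneg _).trans hBs
  by_cases h : |s - s'| < ϱ
  · -- near pair: `s` lies in the disc about `s′`
    have hmem : (s : ℂ) ∈ ball (s' : ℂ) ϱ := by
      rw [mem_ball, dist_eq_norm, norm_real_sub_real]; exact h
    have h1 := norm_sub_centre_le hs' hBs' hmem
    rwa [norm_real_sub_real] at h1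
  · -- far pair: the triangle inequality
    rw [not_lt] at h
    have h2 : 0 ≤ 2 * B / ϱ := div_nonneg (mul_nonneg zero_le_two hB) hϱ.le
    calc ‖Φ s - Φ s'‖ ≤ ‖Φ s‖ + ‖Φ s'‖ := norm_sub_le _ _
      _ ≤ B + B := add_le_add hBs (hBs' s' (mem_ball_self hϱ))
      _ = 2 * B / ϱ * ϱ := by field_simp; ring
      _ ≤ 2 * B / ϱ * |s - s'| := mul_le_mul_of_nonneg_left h h2

/-- The form used below: `Φ` bounded by `B` on the discs about BOTH real points and complex differentiable on the disc about the
second (the shape in which the species binders are displayed: one disc per window history; only one differentiability is consumed).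
[folklore] -/
theorem norm_sub_le_of_holo_pair' {Φ : ℂ → F} {s s' ϱ B : ℝ} (hϱ : 0 < ϱ)
    (hBs : ∀ z ∈ ball (s : ℂ) ϱ, ‖Φ z‖ ≤ B)
    (hs' : DifferentiableOn ℂ Φ (ball (s' : ℂ) ϱ)) (hBs' : ∀ z ∈ ball (s' : ℂ) ϱ, ‖Φ z‖ ≤ B) :
    ‖Φ s - Φ s'‖ ≤ 2 * B / ϱ * |s - s'| :=
  norm_sub_le_of_holo_pair hϱ (hBs s (mem_ball_self hϱ)) hs' hBs'

end Engine

/-! ## §2 The direction map's (d2) from holomorphy in the k-th coupling -/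

section Direction

variable {C : Carriers} {E : Type} {ι α β γ δ : Type} [NormedAddCommGroup E] [NormedSpace ℂ E]

/-- **(d2) FROM HOLOMORPHY IN THE LAST COUPLING.**  Conclusion LITERALLY the binder `hlip` of
`NE9RemainderSpeciesCoupling.cpieceResponse_rem` ∕ `NE9CurveFromBackgroundMap.cpieceResponse_compCur` with `clip := 2∕ϱ`.
DISPLAYED (TYPE, asserted for nothing of Bałaban's): a coupling-complexified direction `dirZ k ζ y □₀ Y₀ (X,·) t s σ` with
(res) on the window the (1.23) direction is its value at `ζ = g k` ([II] (1.23) p. 7: the direction is built from the step-k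
action 𝐇_k and the shift B′ — it reads the history through g_k only); (hol) `ζ ↦ dirZ k ζ …` complex differentiable on
`|ζ − g k| < ϱ`, `g ∈ W`, at every contour point ([I] (2.12) p. 268 «powers of g_k × functions of g_kCB» ∘ [II] p. 6 last ¶ ∕
Lemma 2 p. 11 analyticity — route P1's [S1-c] TYPE); (size) the (3.36)-TYPE relative size `≤ c_dir·ℓ k j·R_X` ON THE DISC ([I]
(3.36) p. 277 — at real coupling this is `dir_le` ∘ `dirB_le` of `RemData.Admissible`).  Engine §1 at `B := c_dir·ℓ k j·R_X`.
[cite: Balaban1988RG2Cluster, (1.23) p.7, Lemma 2 p.11; Balaban1987RG1, (2.12) p.268, (3.36) p.277] -/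
theorem dirLip_of_holo (D : RemData C E ι α β γ δ) {ℓ : ℕ → ℕ → ℝ} {cdir : ℝ} {W : Set (ℕ → ℝ)} {ϱ : ℝ}
    (hϱ : 0 < ϱ) (dirZ : ℕ → ℂ → ι → α → β → (doubleCarriers C).Dom → ℂ → (δ → ℝ) → (δ → ℂ) → E)
    (hres : ∀ g ∈ W, ∀ (k : ℕ) (y : ι), ∀ a ∈ D.S0 k y, ∀ b ∈ D.SY k y a, ∀ (j : ℕ), ∀ x ∈ D.src k y a j,
      ∀ t ∈ sphere (0:ℂ) (D.r k), ∀ (s' : δ → ℝ) (σ' : δ → ℂ), OnContour D.κ₁ (D.cubes k y a b) s' σ' →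
        D.dir k g y a b x t s' σ' = dirZ k (g k : ℂ) y a b x t s' σ')
    (hhol : ∀ g ∈ W, ∀ (k : ℕ) (y : ι), ∀ a ∈ D.S0 k y, ∀ b ∈ D.SY k y a, ∀ (j : ℕ), ∀ x ∈ D.src k y a j,
      ∀ t ∈ sphere (0:ℂ) (D.r k), ∀ (s' : δ → ℝ) (σ' : δ → ℂ), OnContour D.κ₁ (D.cubes k y a b) s' σ' →
        DifferentiableOn ℂ (fun ζ : ℂ => dirZ k ζ y a b x t s' σ') (ball (g k : ℂ) ϱ))
    (hsize : ∀ g ∈ W, ∀ (k : ℕ) (y : ι), ∀ a ∈ D.S0 k y, ∀ b ∈ D.SY k y a, ∀ (j : ℕ), ∀ x ∈ D.src k y a j,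
      ∀ t ∈ sphere (0:ℂ) (D.r k), ∀ (s' : δ → ℝ) (σ' : δ → ℂ), OnContour D.κ₁ (D.cubes k y a b) s' σ' →
        ∀ ζ ∈ ball (g k : ℂ) ϱ, ‖dirZ k ζ y a b x t s' σ'‖ ≤ cdir * ℓ k j * D.R x.1) :
    ∀ g ∈ W, ∀ g' ∈ W, ∀ (k : ℕ) (y : ι), ∀ a ∈ D.S0 k y, ∀ b ∈ D.SY k y a, ∀ (j : ℕ), ∀ x ∈ D.src k y a j,
      ∀ t ∈ sphere (0:ℂ) (D.r k), ∀ (s' : δ → ℝ) (σ' : δ → ℂ), OnContour D.κ₁ (D.cubes k y a b) s' σ' →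
        ‖D.dir k g y a b x t s' σ' - D.dir k g' y a b x t s' σ'‖ ≤ 2 / ϱ * (cdir * ℓ k j * D.R x.1) * |g k - g' k| := by
  intro g hg g' hg' k y a ha b hb j x hx t ht s' σ' hsσ
  rw [hres g hg k y a ha b hb j x hx t ht s' σ' hsσ, hres g' hg' k y a ha b hb j x hx t ht s' σ' hsσ]
  have h := norm_sub_le_of_holo_pair' (Φ := fun ζ : ℂ => dirZ k ζ y a b x t s' σ') (s := g k) (s' := g' k) hϱ
    (hsize g hg k y a ha b hb j x hx t ht s' σ' hsσ)
    (hhol g' hg' k y a ha b hb j x hx t ht s' σ' hsσ) (hsize g' hg' k y a ha b hb j x hx t ht s' σ' hsσ)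
  calc ‖dirZ k (g k : ℂ) y a b x t s' σ' - dirZ k (g' k : ℂ) y a b x t s' σ'‖
      ≤ 2 * (cdir * ℓ k j * D.R x.1) / ϱ * |g k - g' k| := h
    _ = 2 / ϱ * (cdir * ℓ k j * D.R x.1) * |g k - g' k| := by ring

/-- `0 ≤ 2∕ϱ` — the `hclip`∕`hclipd` side condition of the consumers, for the produced constant. [folklore] -/
theorem two_div_nonneg {ϱ : ℝ} (hϱ : 0 < ϱ) : (0 : ℝ) ≤ 2 / ϱ := div_nonneg zero_le_two hϱ.le

end Direction

/-! ## §3 The kernel summand's (K-Lip) from holomorphy in the k-th coupling -/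

section Kernel

variable {C : Carriers} {E : Type} {ι α β γ δ Pt : Type} [NormedAddCommGroup E] [NormedSpace ℂ E]

/-- **(K-Lip) FROM HOLOMORPHY IN THE LAST COUPLING.**  Conclusion LITERALLY the binder `hkerL` of
`NE9KernelSpeciesCoupling.cpieceResponse_ker` ∕ `channelCouplingModulus_ker` with `λ := 2∕ϱ`.  DISPLAYED (TYPE ∕ PROOF-INTERIOR of
[I] §4, asserted for nothing of Bałaban's): a coupling-complexified bilocal summand `kerZ k ζ … p q F` with (res) on the window the
summand is its value at `ζ = g k` (the kernels read the history through `B′ = g_kCB − hD̃(g_kCB)`, [I] (3.2) p. 270); (hol)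
`ζ ↦ kerZ k ζ … p q F` complex differentiable on `|ζ − g k| < ϱ` for every `F` analytic on the source's ball ([I] (2.12) p. 268
structure ∘ §4's analyticity in the fields — route P1's [S1-c] TYPE); (K-on-the-disc) the p. 286 summand bound with the SAME
letters `cK·M·gain k j·(ρd p q)^m·e^{−δ₀(dX p + dX q)}` for `F` bounded by `M`, ON THE DISC (at real coupling it is `kerBound` of
`KerData.Admissible`).  Engine §1 at `B :=` that bound. [cite: Balaban1987RG1, (2.12) p.268, (3.2) p.270, (4.21)-(4.22) pp.285-286] -/
theorem kerLip_of_holo (K : KerData C E ι α β γ δ Pt) {gain : ℕ → ℕ → ℝ} {cK δ₀ : ℝ} {W : Set (ℕ → ℝ)} {ϱ : ℝ}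
    (hϱ : 0 < ϱ)
    (kerZ : ℕ → ℂ → ι → α → β → (doubleCarriers C).Dom → ℂ → (δ → ℝ) → (δ → ℂ) → Pt → Pt → (E → ℂ) → ℂ)
    (hres : ∀ g ∈ W, ∀ (k : ℕ) (y : ι), ∀ a ∈ K.S0 k y, ∀ b ∈ K.SY k y a, ∀ (j : ℕ), ∀ x ∈ K.src k y a j,
      ∀ t ∈ sphere (0:ℂ) (K.r k), ∀ (s' : δ → ℝ) (σ' : δ → ℂ), OnContour K.κ₁ (K.cubes k y a b) s' σ' →
        ∀ p ∈ K.pts k y a, ∀ q ∈ K.pts k y a, ∀ F : E → ℂ, DifferentiableOn ℂ F (ball 0 (K.R x.1)) →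
          K.ker k g y a b x t s' σ' p q F = kerZ k (g k : ℂ) y a b x t s' σ' p q F)
    (hhol : ∀ g ∈ W, ∀ (k : ℕ) (y : ι), ∀ a ∈ K.S0 k y, ∀ b ∈ K.SY k y a, ∀ (j : ℕ), ∀ x ∈ K.src k y a j,
      ∀ t ∈ sphere (0:ℂ) (K.r k), ∀ (s' : δ → ℝ) (σ' : δ → ℂ), OnContour K.κ₁ (K.cubes k y a b) s' σ' →
        ∀ p ∈ K.pts k y a, ∀ q ∈ K.pts k y a, ∀ F : E → ℂ, DifferentiableOn ℂ F (ball 0 (K.R x.1)) →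
          DifferentiableOn ℂ (fun ζ : ℂ => kerZ k ζ y a b x t s' σ' p q F) (ball (g k : ℂ) ϱ))
    (hKdisc : ∀ g ∈ W, ∀ (k : ℕ) (y : ι), ∀ a ∈ K.S0 k y, ∀ b ∈ K.SY k y a, ∀ (j : ℕ), ∀ x ∈ K.src k y a j,
      ∀ t ∈ sphere (0:ℂ) (K.r k), ∀ (s' : δ → ℝ) (σ' : δ → ℂ), OnContour K.κ₁ (K.cubes k y a b) s' σ' →
        ∀ p ∈ K.pts k y a, ∀ q ∈ K.pts k y a, ∀ (F : E → ℂ) (M : ℝ),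
          DifferentiableOn ℂ F (ball 0 (K.R x.1)) → (∀ z ∈ ball (0:E) (K.R x.1), ‖F z‖ ≤ M) →
            ∀ ζ ∈ ball (g k : ℂ) ϱ, ‖kerZ k ζ y a b x t s' σ' p q F‖ ≤
              cK * M * gain k j * K.ρd p q ^ K.m * Real.exp (-(δ₀ * (K.dX x.1 p + K.dX x.1 q)))) :
    ∀ g ∈ W, ∀ g' ∈ W, ∀ (k : ℕ) (y : ι), ∀ a ∈ K.S0 k y, ∀ b ∈ K.SY k y a, ∀ (j : ℕ), ∀ x ∈ K.src k y a j,
      ∀ t ∈ sphere (0:ℂ) (K.r k), ∀ (s' : δ → ℝ) (σ' : δ → ℂ), OnContour K.κ₁ (K.cubes k y a b) s' σ' →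
        ∀ p ∈ K.pts k y a, ∀ q ∈ K.pts k y a, ∀ (F : E → ℂ) (M : ℝ),
          DifferentiableOn ℂ F (ball 0 (K.R x.1)) → (∀ z ∈ ball (0:E) (K.R x.1), ‖F z‖ ≤ M) →
            ‖K.ker k g y a b x t s' σ' p q F - K.ker k g' y a b x t s' σ' p q F‖ ≤
              cK * (2 / ϱ) * M * gain k j * K.ρd p q ^ K.m * Real.exp (-(δ₀ * (K.dX x.1 p + K.dX x.1 q))) *
                |g k - g' k| := by
  intro g hg g' hg' k y a ha b hb j x hx t ht s' σ' hsσ p hp q hq F M hF hM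
  rw [hres g hg k y a ha b hb j x hx t ht s' σ' hsσ p hp q hq F hF,
    hres g' hg' k y a ha b hb j x hx t ht s' σ' hsσ p hp q hq F hF]
  have h := norm_sub_le_of_holo_pair' (Φ := fun ζ : ℂ => kerZ k ζ y a b x t s' σ' p q F) (s := g k) (s' := g' k) hϱ
    (hKdisc g hg k y a ha b hb j x hx t ht s' σ' hsσ p hp q hq F M hF hM)
    (hhol g' hg' k y a ha b hb j x hx t ht s' σ' hsσ p hp q hq F hF)
    (hKdisc g' hg' k y a ha b hb j x hx t ht s' σ' hsσ p hp q hq F M hF hM)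
  calc ‖kerZ k (g k : ℂ) y a b x t s' σ' p q F - kerZ k (g' k : ℂ) y a b x t s' σ' p q F‖
      ≤ 2 * (cK * M * gain k j * K.ρd p q ^ K.m * Real.exp (-(δ₀ * (K.dX x.1 p + K.dX x.1 q)))) / ϱ * |g k - g' k| := h
    _ = cK * (2 / ϱ) * M * gain k j * K.ρd p q ^ K.m * Real.exp (-(δ₀ * (K.dX x.1 p + K.dX x.1 q))) *
          |g k - g' k| := by ring

end Kernel

/-! ## §4 Non-vacuity of the holomorphy binders (sanity `example`s) -/

section Sanity

variable {F : Type*} [NormedAddCommGroup F] [NormedSpace ℂ F]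

/-- A map AFFINE in the complexified coupling, `ζ ↦ u + ζ • v`, is holomorphic on every disc and, on the disc `|ζ − s| < ϱ`,
bounded by `‖u‖ + (|s| + ϱ)·‖v‖` — so (hol)∕(size) of §2 are met with `B := ‖u‖ + (|s| + ϱ)‖v‖` and §1 gives the Lipschitz bound
(which here is also elementary: `‖(s − s′) • v‖`).  Not a model of Bałaban's directions. [folklore] -/
example (u v : F) (s s' ϱ : ℝ) (hϱ : 0 < ϱ) (hss' : |s'| ≤ |s|) :
    ‖(u + (s : ℂ) • v) - (u + (s' : ℂ) • v)‖ ≤ 2 * (‖u‖ + (|s| + ϱ) * ‖v‖) / ϱ * |s - s'| := by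
  have hhol : ∀ c : ℝ, DifferentiableOn ℂ (fun ζ : ℂ => u + ζ • v) (ball (c : ℂ) ϱ) := fun c =>
    ((differentiableOn_const u).add ((differentiable_id.smul_const v).differentiableOn))
  have hsize : ∀ c : ℝ, |c| ≤ |s| → ∀ z ∈ ball (c : ℂ) ϱ, ‖u + z • v‖ ≤ ‖u‖ + (|s| + ϱ) * ‖v‖ := by
    intro c hc z hz
    have hz' : ‖z‖ ≤ |s| + ϱ := by
      have h1 : ‖z - (c : ℂ)‖ < ϱ := by rwa [mem_ball, dist_eq_norm] at hz
      calc ‖z‖ = ‖(z - c) + c‖ := by rw [sub_add_cancel]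
        _ ≤ ‖z - (c : ℂ)‖ + ‖(c : ℂ)‖ := norm_add_le _ _
        _ ≤ ϱ + |c| := by rw [norm_real, Real.norm_eq_abs]; exact add_le_add h1.le le_rfl
        _ ≤ |s| + ϱ := by linarith
    calc ‖u + z • v‖ ≤ ‖u‖ + ‖z • v‖ := norm_add_le _ _
      _ = ‖u‖ + ‖z‖ * ‖v‖ := by rw [norm_smul]
      _ ≤ ‖u‖ + (|s| + ϱ) * ‖v‖ := by gcongr
  exact norm_sub_le_of_holo_pair' (Φ := fun ζ : ℂ => u + ζ • v) hϱ (hsize s le_rfl) (hhol s') (hsize s' hss')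

/-- A summand LINEAR in the complexified coupling with a coefficient obeying a (K)-shape bound `‖c‖ ≤ Kb` meets (hol) and, on the
disc `|ζ − s| < ϱ` with `|s| + ϱ ≤ 1` (couplings and radius inside the unit disc), the bound `‖ζ·c‖ ≤ Kb` — the (K-on-the-disc)
binder of §3 with the same letters as at real coupling. [folklore] -/
example (c : ℂ) (Kb s ϱ : ℝ) (hc : ‖c‖ ≤ Kb) (hs : |s| + ϱ ≤ 1) :
    DifferentiableOn ℂ (fun ζ : ℂ => ζ * c) (ball (s : ℂ) ϱ) ∧ ∀ ζ ∈ ball (s : ℂ) ϱ, ‖ζ * c‖ ≤ Kb := by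
  refine ⟨(differentiable_id.mul_const c).differentiableOn, fun ζ hζ => ?_⟩
  have hKb : 0 ≤ Kb := (norm_nonneg c).trans hc
  have hζ1 : ‖ζ‖ ≤ 1 := by
    have h1 : ‖ζ - (s : ℂ)‖ < ϱ := by rwa [mem_ball, dist_eq_norm] at hζ
    calc ‖ζ‖ = ‖(ζ - s) + s‖ := by rw [sub_add_cancel]
      _ ≤ ‖ζ - (s : ℂ)‖ + ‖(s : ℂ)‖ := norm_add_le _ _
      _ ≤ ϱ + |s| := by rw [norm_real, Real.norm_eq_abs]; exact add_le_add h1.le le_rfl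
      _ ≤ 1 := by linarith
  calc ‖ζ * c‖ = ‖ζ‖ * ‖c‖ := norm_mul _ _
    _ ≤ 1 * Kb := mul_le_mul hζ1 hc (norm_nonneg c) zero_le_one
    _ = Kb := one_mul Kb

end Sanity

end Summit.QuantumFields.BalabanUV.T4Continuum.NE9CouplingHolomorphyLipschitz

end
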